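import Mathlib
import Summits.CriticalPhenomena.SAWScalingLimit.Theses.SAWLoopFugacityFlow
import Literature.Probability.LatticeModels.PlanarIsingOnePointProofs
import Literature.Probability.LatticeModels.PlanarIsingOnePoint

/-!
# Sketch (crux-ideate, ideator 1): first lemmas for the crux `IsingBoundaryRatio`
(stmt-CriticalPhenomena-10650, route SAWLoopFugacityFlow).

Card `fk-anchor-transfer`  : `AnchorTransfer` (K1), `BoundaryFusion` (K3).
Card `pfaffian-slit-peeling`: `oneEdge_identity` (P1), `PeelingIncrement` (first lemma, GBK as hypothesis).
Statements only (no skeleton at this stage).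
-/

open scoped Classical Topology
open Filter Set MeasureTheory
open Literature.Probability.LatticeModels Literature.Probability.RandomPlanarGeometry

namespace Summit.CriticalPhenomena.SAWScalingLimit.Cruxes.IsingBoundaryRatio.Ideator1

/-- The crux's free-b.c. critical two-point function on `Ω_δ` (volume = mesh-domain finset,
`β = β_c(2)`, `h = 0`, free boundary condition), verbatim the expression inside
`IsingBoundaryRatio`. -/
noncomputable def cruxTwoPoint
    (lf : ∀ (Ω : Set ℂ) (δ : ℝ), (discreteDomainGraph Ω δ).LocallyFinite)
    (Ω : Set ℂ) (δ : ℝ) (x y : Site 2) : ℝ :=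
  @isingTwoPoint _ (discreteDomainGraph Ω δ) _ (lf Ω δ)
    (if h : Bornology.IsBounded Ω ∧ 0 < δ then (meshDomain_finite h.1 h.2).toFinset else ∅)
    (Real.log (1 + Real.sqrt 2) / 2) 0 BoundaryCondition.free x y

/-! ## Card `fk-anchor-transfer` -/

/-- **K1 (first lemma, anchor transfer).** The double ratio
`[⟨σ_{aδ}σ_{bδ}⟩_{Ω'} / ⟨σ_{[z]}σ_{[w]}⟩_{Ω'}] / [⟨σ_{aδ}σ_{bδ}⟩_{Ω} / ⟨σ_{[z]}σ_{[w]}⟩_{Ω}]`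
is eventually within `η` of `1` once the bulk anchors `z, w ∈ D'` are `r(η)`-close to `a, b`:
the ratio of boundary-anchored to bulk-anchored two-point functions forgets the domain far from
`a, b` (Edwards–Sokal + arm-origin-forgetting coupling for critical FK-Ising near a free rough
boundary). -/
def AnchorTransfer : Prop :=
  ∀ (lf : ∀ (Ω : Set ℂ) (δ : ℝ), (discreteDomainGraph Ω δ).LocallyFinite)
    (D D' : DobrushinDomain) (a b : ℝ → Site 2),
    SAW.IsEndpointApprox D a b → SAW.IsEndpointApprox D' a b → D'.carrier ⊆ D.carrier →
    (∃ ε : ℝ, 0 < ε ∧ D'.carrier ∩ Metric.ball (D.pt 0) ε = D.carrier ∩ Metric.ball (D.pt 0) ε ∧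
      D'.carrier ∩ Metric.ball (D.pt 1) ε = D.carrier ∩ Metric.ball (D.pt 1) ε) →
    ∀ η : ℝ, 0 < η → ∃ r : ℝ, 0 < r ∧ ∀ z w : ℂ, z ∈ D'.carrier → w ∈ D'.carrier →
      dist z (D.pt 0) < r → dist w (D.pt 1) < r →
      ∀ᶠ δ in 𝓝[>] (0 : ℝ),
        |(cruxTwoPoint lf D'.carrier δ (a δ) (b δ) /
            cruxTwoPoint lf D'.carrier δ (nearestSite δ z) (nearestSite δ w)) /
          (cruxTwoPoint lf D.carrier δ (a δ) (b δ) /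
            cruxTwoPoint lf D.carrier δ (nearestSite δ z) (nearestSite δ w)) - 1| < η

/-- **K2 (bulk input, CHI Thm 1.1 free b.c., ratio form in nested domains).** For fixed interior
anchors the nested ratio of bulk free two-point functions converges to the ratio of CHI's explicit
continuum free two-point functions (`twoPointFreeCHI`; `ρ(δ)` cancels). Here `ψ = φ⁻¹ : D → ℍ`
and `ψ' = Φ ∘ φ⁻¹ : D' → ℍ`. -/
def BulkFreeRatio : Prop :=
  ∀ (lf : ∀ (Ω : Set ℂ) (δ : ℝ), (discreteDomainGraph Ω δ).LocallyFinite)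
    (D D' : DobrushinDomain), D'.carrier ⊆ D.carrier →
    ∀ (φ : ConformalEquiv UpperHalfPlane.upperHalfPlaneSet D.carrier), D.IsChordalUniformizing φ →
    ∀ (A : Set ℂ), A = closure (UpperHalfPlane.upperHalfPlaneSet \
        {z | z ∈ UpperHalfPlane.upperHalfPlaneSet ∧ φ z ∈ D'.carrier}) →
    ∀ (Φ : ConformalEquiv (UpperHalfPlane.upperHalfPlaneSet \ A) UpperHalfPlane.upperHalfPlaneSet),
      IsRestrictionMap A Φ →
    ∀ z w : ℂ, z ∈ D'.carrier → w ∈ D'.carrier → z ≠ w →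
      Tendsto (fun δ => cruxTwoPoint lf D'.carrier δ (nearestSite δ z) (nearestSite δ w) /
          cruxTwoPoint lf D.carrier δ (nearestSite δ z) (nearestSite δ w)) (𝓝[>] 0)
        (𝓝 (twoPointFreeCHI (fun x => Φ (φ.toPartialEquiv.symm x)) z w /
          twoPointFreeCHI (fun x => φ.toPartialEquiv.symm x) z w))

/-- **K3 (continuum boundary fusion).** CHI's explicit free two-point functions of `D' ⊆ D`
fuse at the common boundary points to the weight-`1/2` covariance factor:
`⟨σ_zσ_w⟩^free_{D'} / ⟨σ_zσ_w⟩^free_D → Φ'_A(0)^{1/2}` as `z → a`, `w → b` inside `D'`. -/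
def BoundaryFusion : Prop :=
  ∀ (D D' : DobrushinDomain), D'.carrier ⊆ D.carrier → D'.pt 0 = D.pt 0 → D'.pt 1 = D.pt 1 →
    (∃ ε : ℝ, 0 < ε ∧ D'.carrier ∩ Metric.ball (D.pt 0) ε = D.carrier ∩ Metric.ball (D.pt 0) ε ∧
      D'.carrier ∩ Metric.ball (D.pt 1) ε = D.carrier ∩ Metric.ball (D.pt 1) ε) →
    ∀ (φ : ConformalEquiv UpperHalfPlane.upperHalfPlaneSet D.carrier), D.IsChordalUniformizing φ →
    ∀ (A : Set ℂ), A = closure (UpperHalfPlane.upperHalfPlaneSet \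
        {z | z ∈ UpperHalfPlane.upperHalfPlaneSet ∧ φ z ∈ D'.carrier}) →
    ∀ (Φ : ConformalEquiv (UpperHalfPlane.upperHalfPlaneSet \ A) UpperHalfPlane.upperHalfPlaneSet)
      (d : ℝ), IsRestrictionMap A Φ → HasRestrictionDeriv A Φ d →
      Tendsto (fun p : ℂ × ℂ =>
          twoPointFreeCHI (fun x => Φ (φ.toPartialEquiv.symm x)) p.1 p.2 /
            twoPointFreeCHI (fun x => φ.toPartialEquiv.symm x) p.1 p.2)
        ((𝓝[D'.carrier] (D.pt 0)) ×ˢ (𝓝[D'.carrier] (D.pt 1)))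
        (𝓝 (d ^ ((1 : ℝ) / 2)))

/-! ## Card `pfaffian-slit-peeling` -/

/-- **P1 (one-edge identity, free b.c., any finite graph).** Deleting the edge `uv`:
`⟨σ_aσ_b⟩_G · (1 + x ⟨σ_uσ_v⟩_{G−uv}) = ⟨σ_aσ_b⟩_{G−uv} + x ⟨σ_aσ_bσ_uσ_v⟩_{G−uv}`, `x = tanh β`
(from `e^{βσ_uσ_v} = cosh β (1 + x σ_uσ_v)`). -/
def OneEdgeIdentity : Prop :=
  ∀ (V : Type) [Fintype V] [DecidableEq V] (G G' : SimpleGraph V) [DecidableRel G.Adj]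
    [DecidableRel G'.Adj] (u v a b : V) (β : ℝ), u ≠ v → ¬ G'.Adj u v →
    G = G' ⊔ SimpleGraph.fromEdgeSet {s(u, v)} →
    isingTwoPoint G Finset.univ β 0 .free a b *
        (1 + Real.tanh β * isingTwoPoint G' Finset.univ β 0 .free u v) =
      isingTwoPoint G' Finset.univ β 0 .free a b +
        Real.tanh β * isingExpect G' Finset.univ β 0 .free (fun σ => spinPair a b σ * spinPair u v σ)

/-- **First lemma (peeling increment).** If in `G' = G − uv` the four spins `a, u, v, b` lie on
one face in this cyclic order, the Groeneveld–Boel–Kasteleyn boundary Pfaffian identity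
`⟨σ_aσ_uσ_vσ_b⟩ = ⟨au⟩⟨vb⟩ − ⟨av⟩⟨ub⟩ + ⟨ab⟩⟨uv⟩` (taken here as the hypothesis `hGBK`) turns P1
into the exact discrete Loewner increment
`⟨σ_aσ_b⟩_G = ⟨σ_aσ_b⟩_{G'} + x (⟨au⟩⟨vb⟩ − ⟨av⟩⟨ub⟩)_{G'} / (1 + x⟨uv⟩_{G'})`. -/
def PeelingIncrement : Prop :=
  ∀ (V : Type) [Fintype V] [DecidableEq V] (G G' : SimpleGraph V) [DecidableRel G.Adj]
    [DecidableRel G'.Adj] (u v a b : V) (β : ℝ), u ≠ v → ¬ G'.Adj u v →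
    G = G' ⊔ SimpleGraph.fromEdgeSet {s(u, v)} →
    (isingExpect G' Finset.univ β 0 .free (fun σ => spinPair a b σ * spinPair u v σ) =
      isingTwoPoint G' Finset.univ β 0 .free a u * isingTwoPoint G' Finset.univ β 0 .free v b -
        isingTwoPoint G' Finset.univ β 0 .free a v * isingTwoPoint G' Finset.univ β 0 .free u b +
        isingTwoPoint G' Finset.univ β 0 .free a b * isingTwoPoint G' Finset.univ β 0 .free u v) →
    isingTwoPoint G Finset.univ β 0 .free a b =
      isingTwoPoint G' Finset.univ β 0 .free a b +
        Real.tanh β * (isingTwoPoint G' Finset.univ β 0 .free a u * isingTwoPoint G' Finset.univ β 0 .free v b -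
            isingTwoPoint G' Finset.univ β 0 .free a v * isingTwoPoint G' Finset.univ β 0 .free u b) /
          (1 + Real.tanh β * isingTwoPoint G' Finset.univ β 0 .free u v)

/-- The increment formula is pure algebra from P1 and the GBK hypothesis (provable now). -/
theorem peelingIncrement_of_oneEdge (h : OneEdgeIdentity) : PeelingIncrement := by
  intro V _ _ G G' _ _ u v a b β huv hadj hG hGBK
  have h1 := h V G G' u v a b β huv hadj hG
  rw [hGBK] at h1
  have hpos : 0 < 1 + Real.tanh β * isingTwoPoint G' Finset.univ β 0 .free u v := by
    sorry
  field_simp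
  linarith [h1]

end Summit.CriticalPhenomena.SAWScalingLimit.Cruxes.IsingBoundaryRatio.Ideator1
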